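import Summits.CriticalPhenomena.PercolationContinuityZ3.Theorems.PercNearOneGluingNoHeavyLowerTailIncStarTwoCutBPlus
import Summits.CriticalPhenomena.PercolationContinuityZ3.Theorems.PercNearOneGluingNoHeavyLowerTailIncStarIrreducibleTools
import Literature.Probability.Percolation.FoldingFibres
import Literature.Probability.Percolation.ConnectivityGramMatrix
import Mathlib.Topology.Order.ProjIcc
import Mathlib.Topology.Order.OrderClosed
import HarnessLib

/-!
# Two-cuts with the root and one target on the root side (MODE B), XXV: THEOREM B⁺ without the non-degeneracy provisos

Support file for the Sahi programme (`--supports stmt-CriticalPhenomena-4575`, prover prim-sahi-p2 gen 28).  No definitions, no named facts,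
no sorries; standard axioms plus the computational ancestry of part XXIV.

Part XXIV (`incStar_nonneg_of_twoCut_farStars`) needs the three loner/separation events of the root side to be non-null (the near rows
divide by their probabilities).  Here they are removed by a perturbation: scale the root-side weights by `t < 1` (`w_t = t·w` on the pairs `F`
meeting `R`, `w` elsewhere).  Under `w_t` every root-side pair has weight `< 1`, so the atom "exactly the sure pairs are open" has positive
probability and lies in all three loner events; the far stars do not notice the change (their events are determined off `F`); the near star is
asked for every WEAKENING of the root-side weights (inductively available all the same); and `t ↦ E₃(w_t)` is continuous (a polynomial:
`continuous_real_prodBernoulli`, `continuous_sahiE3`), so `E₃(w) = lim_{t↑1} E₃(w_t) ≥ 0`.  Result: `incStar_nonneg_of_twoCut_farStars'`.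
-/

noncomputable section

namespace Summit.CriticalPhenomena.PercolationContinuityZ3.Theorems

namespace IncStarTwoCut

open MeasureTheory Set Filter Topology Literature.Probability.Percolation Literature.Probability.LatticeModels
open Literature.Probability.Percolation.BHK2006 (weight)
open Literature.Probability.Percolation.DecisionTree (ind)
open scoped Classical

variable {n : ℕ}

/-! ### Continuity of probabilities and of `E₃` along a continuous family of weights -/

/-- Along a family of weights `wt : ℝ → (pairs → [0,1])` whose every coordinate is continuous, the probability of any event is continuous.
[folklore] -/
theorem continuous_real_prodBernoulli {ι : Type*} [Fintype ι] (wt : ℝ → ι → unitInterval) (hcont : ∀ e, Continuous fun t => (wt t e : ℝ))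
    (E : Set (Set ι)) : Continuous fun t => (prodBernoulli (wt t)).real E := by
  have h : (fun t => (prodBernoulli (wt t)).real E) = fun t => ∑ a : Set ι, weight (fun e => (wt t e : ℝ)) a * ind E a :=
    funext fun t => prodBernoulli_real_eq_sum_weight_ind (wt t) E
  rw [h]
  refine continuous_finsetSum _ fun a _ => Continuous.mul ?_ continuous_const
  unfold weight
  refine continuous_finsetProd _ fun e _ => ?_
  by_cases he : e ∈ a
  · simp only [he, ↓reduceIte]; exact hcont e
  · simp only [he, ↓reduceIte]; exact continuous_const.sub (hcont e)

/-- Along such a family, `E₃` of three fixed events is continuous. [folklore] -/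
theorem continuous_sahiE3 {ι : Type*} [Fintype ι] (wt : ℝ → ι → unitInterval) (hcont : ∀ e, Continuous fun t => (wt t e : ℝ))
    (A B C : Set (Set ι)) : Continuous fun t => sahiE3 (prodBernoulli (wt t)) A B C := by
  have h := fun E => continuous_real_prodBernoulli wt hcont E
  simp only [sahiE3_def]
  exact ((continuous_const.mul (h _)).add (((h _).mul (h _)).mul (h _))).sub
    ((((h _).mul (h _)).add ((h _).mul (h _))).add ((h _).mul (h _)))

/-! ### The loner events are non-null when every root-side pair has weight `< 1` -/

/-- If every pair of `F` has weight `< 1` and `x ≠ y`, `x ≠ z`, then the event "inside `F`, `x` is joined neither to `y` nor to `z`" has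
positive probability (it contains the atom "exactly the sure pairs are open"). [this work] -/
theorem real_loner_pos (w : Sym2 (Fin n) → unitInterval) (F : Set (Sym2 (Fin n))) (hF : ∀ e ∈ F, (w e : ℝ) < 1) {x y z : Fin n}
    (hxy : x ≠ y) (hxz : x ≠ z) :
    0 < (prodBernoulli w).real {ω | ω ∩ F ∈ ((openConn x y)ᶜ ∩ (openConn x z)ᶜ : Set (BondConfig (Fin n)))} := by
  set ω₀ : BondConfig (Fin n) := {e | (w e : ℝ) = 1} with hω₀
  have hpos : 0 < (prodBernoulli w).real {ω₀} := by
    refine ConnGram.real_singleton_pos w (fun e he => ?_) (fun e he => ?_)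
    · have : (w e : ℝ) = 1 := he
      rw [this]; exact one_pos
    · have : (w e : ℝ) ≠ 1 := he
      exact lt_of_le_of_ne (w e).2.2 this
  have hempty : ω₀ ∩ F = ∅ := by
    refine Set.eq_empty_of_forall_notMem fun e he => ?_
    have h1 : (w e : ℝ) = 1 := he.1
    exact absurd h1 (ne_of_lt (hF e he.2))
  have hsub : ({ω₀} : Set (BondConfig (Fin n))) ⊆ {ω | ω ∩ F ∈ ((openConn x y)ᶜ ∩ (openConn x z)ᶜ : Set (BondConfig (Fin n)))} := by
    intro ω hω
    rw [Set.mem_singleton_iff] at hω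
    subst hω
    simp only [Set.mem_setOf_eq, hempty, Set.mem_inter_iff, Set.mem_compl_iff, openConn, openGraph, SimpleGraph.fromEdgeSet_empty,
      SimpleGraph.reachable_bot]
    exact ⟨hxy, hxz⟩
  exact lt_of_lt_of_le hpos (measureReal_mono hsub)

/-- The same for the triple separation event `{s ≁ u, s ≁ v, u ≁ v inside F}`. [this work] -/
theorem real_loner₃_pos (w : Sym2 (Fin n) → unitInterval) (F : Set (Sym2 (Fin n))) (hF : ∀ e ∈ F, (w e : ℝ) < 1) {s u v : Fin n}
    (hsu : s ≠ u) (hsv : s ≠ v) (huv : u ≠ v) :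
    0 < (prodBernoulli w).real {ω | ω ∩ F ∈ ((openConn s u)ᶜ ∩ (openConn s v)ᶜ ∩ (openConn u v)ᶜ : Set (BondConfig (Fin n)))} := by
  set ω₀ : BondConfig (Fin n) := {e | (w e : ℝ) = 1} with hω₀
  have hpos : 0 < (prodBernoulli w).real {ω₀} := by
    refine ConnGram.real_singleton_pos w (fun e he => ?_) (fun e he => ?_)
    · have : (w e : ℝ) = 1 := he
      rw [this]; exact one_pos
    · have : (w e : ℝ) ≠ 1 := he
      exact lt_of_le_of_ne (w e).2.2 this
  have hempty : ω₀ ∩ F = ∅ := by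
    refine Set.eq_empty_of_forall_notMem fun e he => ?_
    have h1 : (w e : ℝ) = 1 := he.1
    exact absurd h1 (ne_of_lt (hF e he.2))
  have hsub : ({ω₀} : Set (BondConfig (Fin n))) ⊆
      {ω | ω ∩ F ∈ ((openConn s u)ᶜ ∩ (openConn s v)ᶜ ∩ (openConn u v)ᶜ : Set (BondConfig (Fin n)))} := by
    intro ω hω
    rw [Set.mem_singleton_iff] at hω
    subst hω
    simp only [Set.mem_setOf_eq, hempty, Set.mem_inter_iff, Set.mem_compl_iff, openConn, openGraph, SimpleGraph.fromEdgeSet_empty,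
      SimpleGraph.reachable_bot]
    exact ⟨⟨hsu, hsv⟩, huv⟩
  exact lt_of_lt_of_le hpos (measureReal_mono hsub)

/-! ### THEOREM B⁺ without non-degeneracy -/

set_option maxHeartbeats 800000 in
/-- **THEOREM B⁺** (no non-degeneracy provisos).  Bond percolation `prodBernoulli w` on `Fin n`; a root side `R ∋ s`; `u ≠ v` outside `R`
with no positive pair from `R` to the outside of `R ∪ {u, v}`; targets `a ∈ R ∪ {u, v}`, `b, c ∉ R`.  IF the near star `E₃(Ba, Xu, Xv) ≥ 0`
of the root-side events holds for EVERY weakening `w'` of `w` on the root-side pairs `F` (`w' = w` off `F`, `w' ≤ w` on `F`), and the two far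
stars `E₃({u~v},{u~b},{u~c} in Rᶜ)`, `E₃({v~u},{v~b},{v~c} in Rᶜ)` are `≥ 0` under `w`, THEN `E₃({s↔a},{s↔b},{s↔c}) ≥ 0`. [this work] -/
theorem incStar_nonneg_of_twoCut_farStars' (w : Sym2 (Fin n) → unitInterval) (R : Set (Fin n)) {s u v a b c : Fin n}
    (hs : s ∈ R) (ha : a ∈ R ∨ a = u ∨ a = v) (hb : b ∉ R) (hc : c ∉ R) (hu : u ∉ R) (hv : v ∉ R) (huv : u ≠ v)
    (hw : ∀ x ∈ R, ∀ z, z ∉ R → z ≠ u → z ≠ v → w s(x, z) = 0)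
    {F : Set (Sym2 (Fin n))} (hF : F = {e : Sym2 (Fin n) | ∃ y ∈ R, y ∈ e})
    {Xu Xv Ba : Set (BondConfig (Fin n))}
    (hXu : Xu = {ω | ω ∩ F ∈ (openConn s u : Set (BondConfig (Fin n)))})
    (hXv : Xv = {ω | ω ∩ F ∈ (openConn s v : Set (BondConfig (Fin n)))})
    (hBa : Ba = {ω | ω ∩ F ∈ (openConn s a : Set (BondConfig (Fin n)))})
    (hNa : ∀ w' : Sym2 (Fin n) → unitInterval, (∀ e, e ∉ F → w' e = w e) → (∀ e ∈ F, (w' e : ℝ) ≤ w e) →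
      0 ≤ sahiE3 (prodBernoulli w') Ba Xu Xv)
    (hSu : 0 ≤ sahiE3 (prodBernoulli w) (openConnIn Rᶜ u v) (openConnIn Rᶜ u b) (openConnIn Rᶜ u c))
    (hSv : 0 ≤ sahiE3 (prodBernoulli w) (openConnIn Rᶜ v u) (openConnIn Rᶜ v b) (openConnIn Rᶜ v c)) :
    0 ≤ sahiE3 (prodBernoulli w) (openConn s a) (openConn s b) (openConn s c) := by
  have hus : u ≠ s := fun h => hu (h ▸ hs)
  have hvs : v ≠ s := fun h => hv (h ▸ hs)
  -- the scaled family
  obtain ⟨wt, hwt⟩ : ∃ wt : ℝ → Sym2 (Fin n) → unitInterval,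
      ∀ t e, wt t e = if e ∈ F then Set.projIcc (0 : ℝ) 1 zero_le_one (t * w e) else w e := ⟨_, fun t e => rfl⟩
  have hcont : ∀ e, Continuous fun t => (wt t e : ℝ) := by
    intro e
    by_cases he : e ∈ F
    · have : (fun t => (wt t e : ℝ)) = fun t => ((Set.projIcc (0 : ℝ) 1 zero_le_one (t * w e) : unitInterval) : ℝ) :=
        funext fun t => by rw [hwt, if_pos he]
      rw [this]
      exact continuous_subtype_val.comp (continuous_projIcc.comp (continuous_id.mul continuous_const))
    · have : (fun t => (wt t e : ℝ)) = fun _ => (w e : ℝ) := funext fun t => by rw [hwt, if_neg he]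
      rw [this]; exact continuous_const
  have hoff : ∀ t e, e ∉ F → wt t e = w e := fun t e he => by rw [hwt, if_neg he]
  have hon : ∀ t ∈ Set.Icc (0 : ℝ) 1, ∀ e ∈ F, (wt t e : ℝ) = t * w e := by
    intro t ht e he
    have hm : t * (w e : ℝ) ∈ Set.Icc (0 : ℝ) 1 :=
      ⟨mul_nonneg ht.1 (w e).2.1, by nlinarith [ht.2, (w e).2.1, (w e).2.2]⟩
    rw [hwt, if_pos he, Set.projIcc_of_mem zero_le_one hm]
  have hone : wt 1 = w := by
    funext e
    by_cases he : e ∈ F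
    · exact Subtype.ext (by rw [hon 1 ⟨zero_le_one, le_rfl⟩ e he, one_mul])
    · exact hoff 1 e he
  -- the star under `wt t` for `t ∈ [0,1)`
  have hstar : ∀ t ∈ Set.Ico (0 : ℝ) 1, 0 ≤ sahiE3 (prodBernoulli (wt t)) (openConn s a) (openConn s b) (openConn s c) := by
    intro t ht
    have htI : t ∈ Set.Icc (0 : ℝ) 1 := ⟨ht.1, le_of_lt ht.2⟩
    have hlt : ∀ e ∈ F, (wt t e : ℝ) < 1 := fun e he => by
      rw [hon t htI e he]
      calc t * (w e : ℝ) ≤ t * 1 := mul_le_mul_of_nonneg_left (w e).2.2 ht.1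
        _ < 1 := by rw [mul_one]; exact ht.2
    have hw' : ∀ x ∈ R, ∀ z, z ∉ R → z ≠ u → z ≠ v → wt t s(x, z) = 0 := by
      intro x hx z hz hzu hzv
      have hmem : s(x, z) ∈ F := by rw [hF]; exact ⟨x, hx, Sym2.mem_mk_left x z⟩
      exact Subtype.ext (by rw [hon t htI _ hmem, hw x hx z hz hzu hzv]; simp)
    have hfar : ∀ e : Sym2 (Fin n), ¬ e.IsDiag → (∀ z ∈ e, z ∈ Rᶜ) → w e = wt t e := by
      intro e _ he
      have hnot : e ∉ F := by
        rw [hF]; rintro ⟨y, hy, hye⟩; exact he y hye hy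
      rw [hoff t e hnot]
    have hSu' := hSu
    have hSv' := hSv
    rw [IncStarIrreducible.sahiE3_openConnIn_congr_weight w (wt t) Rᶜ hfar] at hSu' hSv'
    have hNa' : 0 ≤ sahiE3 (prodBernoulli (wt t)) Ba Xu Xv :=
      hNa (wt t) (fun e he => hoff t e he) (fun e he => by
        rw [hon t htI e he]; exact mul_le_of_le_one_left (w e).2.1 htI.2)
    exact incStar_nonneg_of_twoCut_farStars (wt t) R hs ha hb hc hu hv huv hw' hF hXu hXv hBa
      (real_loner_pos (wt t) F hlt hus huv) (real_loner_pos (wt t) F hlt hvs (Ne.symm huv))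
      (real_loner₃_pos (wt t) F hlt (Ne.symm hus) (Ne.symm hvs) huv) hNa' hSu' hSv'
  -- pass to the limit `t ↑ 1`
  have hg := continuous_sahiE3 wt hcont (openConn s a : Set (BondConfig (Fin n))) (openConn s b) (openConn s c)
  have hlim : Tendsto (fun t => sahiE3 (prodBernoulli (wt t)) (openConn s a) (openConn s b) (openConn s c)) (𝓝[<] (1 : ℝ))
      (𝓝 (sahiE3 (prodBernoulli (wt 1)) (openConn s a) (openConn s b) (openConn s c))) :=
    hg.continuousAt.tendsto.mono_left nhdsWithin_le_nhds
  have hev : ∀ᶠ t in 𝓝[<] (1 : ℝ), 0 ≤ sahiE3 (prodBernoulli (wt t)) (openConn s a) (openConn s b) (openConn s c) :=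
    Filter.mem_of_superset (Ioo_mem_nhdsLT zero_lt_one) fun t ht => hstar t ⟨le_of_lt ht.1, ht.2⟩
  have key := ge_of_tendsto hlim hev
  rwa [hone] at key

end IncStarTwoCut

end Summit.CriticalPhenomena.PercolationContinuityZ3.Theorems

end
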